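import Summits.ValiantsHypothesis.ValiantsHypothesis.Theorems.KPlusLogSqLawTropicalBComparabilitySum
import Summits.ValiantsHypothesis.ValiantsHypothesis.Theorems.KPlusLogSqLawTropicalBAdjacentRecordsCount

/-!
# `TropicalB` (stmt-ValiantsHypothesis-19771) — the LINEAR COMPARABILITY LAW: two registers coupled only through an order
# constraint `y < p` carry at most `(3(N+U)+1)·L` dominant terms (no logarithm)

Helper file for the crux `Theses.KPlusLogSqLaw.TropicalB` (`--supports stmt-ValiantsHypothesis-19771 --as helper`), cell
`pub-symmetroid`, seat val-sym-trop-p5 (g5, refuter-adjacent lane: «the cheapest counterexample family against the stubs as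
typed, or the obstruction to one»).  HONEST FRAMING: a structure theorem about a SUB-FAMILY of the terms of an ARBITRARY design, in
the tree's vocabulary (`IsDominant`, `tropWeight`, `termSign`); same hypotheses, verbatim, as the tree's COMPARABILITY-SUM LAW
`ComparabilitySum.card_dominant_le` (val-sym-trop-p2 g4, p476777), whose bound `(N+U)·L·(⌊log₂ L⌋+1)` it improves to
`(3(N+U)+1)·L`.  It proves nothing about `TropicalB` in its window and bears on neither `WeakLifting`, `MatrixDescartes`
(stmt-ValiantsHypothesis-18050) nor VP ≠ VNP.

## Statement (`card_dominant_le_linear`)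
Inside any design `(d, v, ε)` of format `(m, K)` take terms `τ j y p u` (`j < N`, `y, p < L`, `u < U`) which, whenever `y < p`,
are present, pairwise distinct, and have weights `tropWeight d v θ (τ j y p u) = θ·(s₁ j y + s₂ p u) − (A j y + B p u)` for
arbitrary integer tables — two REGISTERS whose slopes and valuations add, interacting ONLY through the comparability constraint
`y < p` on their positions in a common window of length `L`.  THEN at most `(3(N+U)+1)·L` such members are dominant (each at
some integer slope, against all present terms).  So the comparability coupling costs a CONSTANT factor over the direct sum
(`≍ (N+U)·L` register points), not the logarithm of the halving argument and not the third factor `≍ L` that slope counting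
allows (`≍ N·U·L²`).  WHY IT MATTERS for the crux (refuter side): the halving bound left open whether chains of `r` interval
registers (two-pivot cycles through `r` pivots, memo val-sym-trop-p2 g4 PASS-THROUGH) could carry `(#points)·(log L)^{r−1}`
dominant terms — with `r ≍ log² m` registers that would have been a counterexample to `TropicalB` (and a super-Carstensen Birkhoff
shadow); for `r = 2` this file shows the logarithm is not there.  Numerics behind it (seat folder exp/mask1b.py, `N = U = 1`,
exact hull counts, hill-climbing lower bounds): `L = 8, 9, 10, 12 ↦ 15, 18, 19, 22 ≈ 2L` dominant members.

## Proof (a kinetic record argument instead of halving)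
Write `u_{jy}(θ) = θ·s₁ j y − A j y`, `w_{pu}(θ) = θ·s₂ p u − B p u`.  At slope `θ` call a position `z` a PREFIX RECORD if some
state `(j, z)` strictly beats every state at every position `< z` (`u`-values), and a SUFFIX RECORD if some `(z, u)` strictly beats
every state at every position `> z` (`w`-values).  (1) A member `(j,y,p,u)` dominant at `θ` beats the feasible competitors
`(j',y',p,u)` (`y' < p`) and `(j,y,p',u')` (`p' > y`) (`u_lt_of_dominant`, `w_lt_of_dominant`), so `y` is a prefix record, `p` a
suffix record, and NO position strictly between them is a record of either kind: `(y, p)` is an ADJACENT record pair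
(`adjacent_of_dominant`).  (2) Sort the dominant members by slope (distinct slopes, `ComparabilitySum.eq_of_theta_eq`).  For a fixed
state `(j, z)` the set of slopes at which it beats everything to its left is convex, so along the sorted members «`z` is a prefix
record» is an OR of `N` interval-shaped predicates and flips at most `2N` times (part 1 `card_flips_exists_le`).  (3) Along
members with the same first position `y`, the state `j` can only move to larger `s₁ j y` (the two members beat each other's first
state at their respective slopes).  (4) Part 2 (`card_le_of_adjacent_records`) turns (1)–(3) into the count `(3(N+U)+1)·L`.
[folklore-level: records of a kinetic tournament; the exchange steps are the tree's `ComparabilitySum.weight_lt`]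
-/

set_option linter.dupNamespace false
set_option autoImplicit false

namespace Summit.ValiantsHypothesis.ValiantsHypothesis.Theorems.KPlusLogSqLaw.ComparabilityLinear

open Summit.ValiantsHypothesis.ValiantsHypothesis.Theorems.MatrixDescartes.Negative
open Summit.ValiantsHypothesis.ValiantsHypothesis.Theorems.KPlusLogSqLaw.ComparabilitySum (weight_lt eq_of_theta_eq)
open Finset

section Family

variable {m K N L U : ℕ}
  (d : Fin K → ℕ) (v ε : Fin m → Fin m → Fin K → ℤ)
  (τ : Fin N → Fin L → Fin L → Fin U → Equiv.Perm (Fin m) × (Fin m → Fin K))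
  (s₁ : Fin N → Fin L → ℤ) (s₂ : Fin L → Fin U → ℤ) (A : Fin N → Fin L → ℤ) (B : Fin L → Fin U → ℤ)
  (hinj : ∀ j y p u j' y' p' u', y < p → y' < p' → τ j y p u = τ j' y' p' u' →
    j = j' ∧ y = y' ∧ p = p' ∧ u = u')
  (hpres : ∀ j y p u, y < p → termSign ε (τ j y p u) ≠ 0)
  (hw : ∀ j y p u (θ : ℤ), y < p →
    tropWeight d v θ (τ j y p u) = θ * (s₁ j y + s₂ p u) - (A j y + B p u))

include hinj hpres hw in
/-- PREFIX comparison: a member `(j,y,p,u)` dominant at `θ` beats the first-register state `(j',y')` of every position `y' < p`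
(the competitor `(j',y',p,u)` is feasible). -/
theorem u_lt_of_dominant {j j' : Fin N} {y y' p : Fin L} {u : Fin U} {θ : ℤ} (hyp : y < p) (hy'p : y' < p)
    (hdom : IsDominant d v ε θ (τ j y p u)) (hne : ¬ (j = j' ∧ y = y')) :
    θ * s₁ j' y' - A j' y' < θ * s₁ j y - A j y := by
  have h := weight_lt d v ε τ s₁ s₂ A B hinj hpres hw hyp hy'p hdom (j' := j') (u' := u)
    (by rintro ⟨a, b, -, -⟩; exact hne ⟨a, b⟩)
  linarith

include hinj hpres hw in
/-- SUFFIX comparison: a member `(j,y,p,u)` dominant at `θ` beats the second-register state `(p',u')` of every position `p' > y`. -/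
theorem w_lt_of_dominant {j : Fin N} {y p p' : Fin L} {u u' : Fin U} {θ : ℤ} (hyp : y < p) (hyp' : y < p')
    (hdom : IsDominant d v ε θ (τ j y p u)) (hne : ¬ (p = p' ∧ u = u')) :
    θ * s₂ p' u' - B p' u' < θ * s₂ p u - B p u := by
  have h := weight_lt d v ε τ s₁ s₂ A B hinj hpres hw hyp hyp' hdom (j' := j) (u' := u')
    (by rintro ⟨-, -, a, b⟩; exact hne ⟨a, b⟩)
  linarith

include hinj hpres hw in
/-- **A dominant member's positions form an ADJACENT RECORD PAIR**: `y` is a strict prefix record of the first register at `θ`,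
`p` a strict suffix record of the second, and no position strictly between them is a record of either kind. -/
theorem adjacent_of_dominant {j : Fin N} {y p : Fin L} {u : Fin U} {θ : ℤ} (hyp : y < p)
    (hdom : IsDominant d v ε θ (τ j y p u)) :
    (∃ j₀ : Fin N, ∀ (j' : Fin N) (y' : Fin L), y' < y → θ * s₁ j' y' - A j' y' < θ * s₁ j₀ y - A j₀ y) ∧
    (∃ u₀ : Fin U, ∀ (u' : Fin U) (p' : Fin L), p < p' → θ * s₂ p' u' - B p' u' < θ * s₂ p u₀ - B p u₀) ∧
    y < p ∧
    ∀ z : Fin L, y < z → z < p →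
      (¬ ∃ j₀ : Fin N, ∀ (j' : Fin N) (y' : Fin L), y' < z → θ * s₁ j' y' - A j' y' < θ * s₁ j₀ z - A j₀ z) ∧
      (¬ ∃ u₀ : Fin U, ∀ (u' : Fin U) (p' : Fin L), z < p' → θ * s₂ p' u' - B p' u' < θ * s₂ z u₀ - B z u₀) := by
  refine ⟨⟨j, fun j' y' hy' => ?_⟩, ⟨u, fun u' p' hp' => ?_⟩, hyp, fun z hyz hzp => ⟨?_, ?_⟩⟩
  · exact u_lt_of_dominant d v ε τ s₁ s₂ A B hinj hpres hw hyp (hy'.trans hyp) hdom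
      (by rintro ⟨-, e⟩; exact absurd e (ne_of_gt hy'))
  · exact w_lt_of_dominant d v ε τ s₁ s₂ A B hinj hpres hw hyp (hyp.trans hp') hdom
      (by rintro ⟨e, -⟩; exact absurd e (ne_of_lt hp'))
  · rintro ⟨j₀, h⟩
    have h1 := h j y hyz
    have h2 := u_lt_of_dominant d v ε τ s₁ s₂ A B hinj hpres hw hyp hzp hdom (j' := j₀)
      (by rintro ⟨-, e⟩; exact absurd e (ne_of_lt hyz))
    linarith
  · rintro ⟨u₀, h⟩
    have h1 := h u p hzp
    have h2 := w_lt_of_dominant d v ε τ s₁ s₂ A B hinj hpres hw hyp hyz hdom (u' := u₀)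
      (by rintro ⟨e, -⟩; exact absurd e (ne_of_gt hzp))
    linarith

open scoped Classical in
include hinj hpres hw in
/-- **THE LINEAR COMPARABILITY LAW.**  Under the hypotheses of `ComparabilitySum.card_dominant_le` (two registers with additive
slopes and valuations, members present and pairwise distinct whenever `y < p`), at most `(3(N+U)+1)·L` members with `y < p` are
dominant: linear in the number `(N+U)·L` of register points — the comparability constraint costs a constant, not a logarithm. -/
theorem card_dominant_le_linear :
    ((Finset.univ : Finset (Fin N × Fin L × Fin L × Fin U)).filter (fun i => i.2.1 < i.2.2.1 ∧
        ∃ θ : ℤ, IsDominant d v ε θ (τ i.1 i.2.1 i.2.2.1 i.2.2.2))).card ≤ (3 * (N + U) + 1) * L := by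
  classical
  set D := (Finset.univ : Finset (Fin N × Fin L × Fin L × Fin U)).filter (fun i => i.2.1 < i.2.2.1 ∧
        ∃ θ : ℤ, IsDominant d v ε θ (τ i.1 i.2.1 i.2.2.1 i.2.2.2)) with hD
  have hmemD : ∀ i ∈ D, i.2.1 < i.2.2.1 ∧ ∃ θ : ℤ, IsDominant d v ε θ (τ i.1 i.2.1 i.2.2.1 i.2.2.2) :=
    fun i hi => (Finset.mem_filter.1 hi).2
  have hex : ∀ i ∈ D, ∃ θ : ℤ, IsDominant d v ε θ (τ i.1 i.2.1 i.2.2.1 i.2.2.2) := fun i hi => (hmemD i hi).2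
  choose! Θ hΘ using hex
  -- distinct members are dominant at distinct slopes
  have hΘinj : Set.InjOn Θ ↑D := by
    intro i hi i' hi' he
    have hi₁ := Finset.mem_coe.1 hi
    have hi₂ := Finset.mem_coe.1 hi'
    have h1 := hΘ i hi₁
    have h2 := hΘ i' hi₂
    rw [he] at h1
    obtain ⟨e1, e2, e3, e4⟩ :=
      eq_of_theta_eq d v ε τ s₁ s₂ A B hinj hpres hw (hmemD i hi₁).1 (hmemD i' hi₂).1 h1 h2
    exact Prod.ext e1 (Prod.ext e2 (Prod.ext e3 e4))
  rcases Nat.eq_zero_or_pos D.card with h0 | hpos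
  · rw [h0]; exact Nat.zero_le _
  obtain ⟨i₀, hi₀⟩ := Finset.card_pos.1 hpos
  -- enumerate the members by increasing slope
  set n := D.card with hn
  have hT : (D.image Θ).card = n := Finset.card_image_of_injOn hΘinj
  let e : Fin n ↪o ℤ := (D.image Θ).orderEmbOfFin hT
  have hmemT : ∀ k : Fin n, ∃ i ∈ D, Θ i = e k := fun k => by
    have h := Finset.orderEmbOfFin_mem (D.image Θ) hT k
    simpa only [Finset.mem_image] using h
  choose member hmem hΘmem using hmemT
  let mem' : ℕ → Fin N × Fin L × Fin L × Fin U := fun k => if h : k < n then member ⟨k, h⟩ else i₀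
  have hmem'D : ∀ k, k < n → mem' k ∈ D := by
    intro k hk; simp only [mem', dif_pos hk]; exact hmem _
  have hmem'Θ : ∀ k (hk : k < n), Θ (mem' k) = e ⟨k, hk⟩ := by
    intro k hk; simp only [mem', dif_pos hk]; exact hΘmem _
  let t : ℕ → ℤ := fun k => Θ (mem' k)
  have ht : ∀ k k', k < k' → k' < n → t k < t k' := by
    intro k k' hkk' hk'
    show Θ (mem' k) < Θ (mem' k')
    rw [hmem'Θ k (hkk'.trans hk'), hmem'Θ k' hk']
    exact e.strictMono (Fin.mk_lt_mk.2 hkk')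
  have hmem'inj : ∀ k k', k < n → k' < n → mem' k = mem' k' → k = k' := by
    intro k k' hk hk' heq
    have h1 : e ⟨k, hk⟩ = e ⟨k', hk'⟩ := by rw [← hmem'Θ k hk, ← hmem'Θ k' hk', heq]
    have h2 := e.injective h1
    simpa using h2
  -- the member data
  let jj : ℕ → Fin N := fun k => (mem' k).1
  let y : ℕ → Fin L := fun k => (mem' k).2.1
  let p : ℕ → Fin L := fun k => (mem' k).2.2.1
  let uu : ℕ → Fin U := fun k => (mem' k).2.2.2
  have hyp : ∀ k, k < n → y k < p k := fun k hk => (hmemD _ (hmem'D k hk)).1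
  have hdom : ∀ k, k < n → IsDominant d v ε (t k) (τ (jj k) (y k) (p k) (uu k)) := fun k hk => hΘ _ (hmem'D k hk)
  -- the record predicates and record configurations
  let RA : Fin L → Fin N → ℕ → Prop := fun z j₀ k =>
    ∀ (j' : Fin N) (y' : Fin L), y' < z → t k * s₁ j' y' - A j' y' < t k * s₁ j₀ z - A j₀ z
  let RB : Fin L → Fin U → ℕ → Prop := fun z u₀ k =>
    ∀ (u' : Fin U) (p' : Fin L), z < p' → t k * s₂ p' u' - B p' u' < t k * s₂ z u₀ - B z u₀
  let Ar : ℕ → Finset (Fin L) := fun k => (Finset.univ : Finset (Fin L)).filter (fun z => ∃ j₀, RA z j₀ k)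
  let Br : ℕ → Finset (Fin L) := fun k => (Finset.univ : Finset (Fin L)).filter (fun z => ∃ u₀, RB z u₀ k)
  have hmemAr : ∀ k z, z ∈ Ar k ↔ ∃ j₀, RA z j₀ k := fun k z => by
    simp only [Ar, Finset.mem_filter, Finset.mem_univ, true_and]
  have hmemBr : ∀ k z, z ∈ Br k ↔ ∃ u₀, RB z u₀ k := fun k z => by
    simp only [Br, Finset.mem_filter, Finset.mem_univ, true_and]
  -- (1) adjacency
  have hadj : ∀ k, k < n → y k ∈ Ar k ∧ p k ∈ Br k ∧ y k < p k ∧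
      ∀ z : Fin L, y k < z → z < p k → z ∉ Ar k ∧ z ∉ Br k := by
    intro k hk
    obtain ⟨h1, h2, h3, h4⟩ := adjacent_of_dominant d v ε τ s₁ s₂ A B hinj hpres hw (hyp k hk) (hdom k hk)
    refine ⟨(hmemAr k _).2 h1, (hmemBr k _).2 h2, h3, fun z hyz hzp => ?_⟩
    obtain ⟨h5, h6⟩ := h4 z hyz hzp
    exact ⟨fun h => h5 ((hmemAr k z).1 h), fun h => h6 ((hmemBr k z).1 h)⟩
  -- (2) distinctness
  have hinj' : ∀ k k', k < n → k' < n → jj k = jj k' → y k = y k' → p k = p k' → uu k = uu k' → k = k' := by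
    intro k k' hk hk' e1 e2 e3 e4
    exact hmem'inj k k' hk hk' (Prod.ext e1 (Prod.ext e2 (Prod.ext e3 e4)))
  -- (3) few flips: each record predicate is interval-shaped in time
  have hRA : ∀ z j₀, ∀ a b c : ℕ, a < b → b < c → c < n → RA z j₀ a → RA z j₀ c → RA z j₀ b := by
    intro z j₀ a b c hab hbc hc ha hc' j' y' hy'
    have h1 := ha j' y' hy'
    have h2 := hc' j' y' hy'
    have t1 := ht a b hab (hbc.trans hc)
    have t2 := ht b c hbc hc
    rcases le_or_gt (s₁ j' y' - s₁ j₀ z) 0 with hs | hs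
    · nlinarith
    · nlinarith
  have hRB : ∀ z u₀, ∀ a b c : ℕ, a < b → b < c → c < n → RB z u₀ a → RB z u₀ c → RB z u₀ b := by
    intro z u₀ a b c hab hbc hc ha hc' u' p' hp'
    have h1 := ha u' p' hp'
    have h2 := hc' u' p' hp'
    have t1 := ht a b hab (hbc.trans hc)
    have t2 := ht b c hbc hc
    rcases le_or_gt (s₂ p' u' - s₂ z u₀) 0 with hs | hs
    · nlinarith
    · nlinarith
  have hflipA : ∀ z : Fin L,
      ((Finset.range n).filter (fun k => k + 1 < n ∧ ¬ (z ∈ Ar k ↔ z ∈ Ar (k + 1)))).card ≤ 2 * N := by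
    intro z
    refine le_trans (Finset.card_le_card ?_) (card_flips_exists_le n N (fun j₀ k => RA z j₀ k) (hRA z))
    intro k hk
    simp only [Finset.mem_filter] at hk ⊢
    rw [hmemAr, hmemAr] at hk
    exact hk
  have hflipB : ∀ z : Fin L,
      ((Finset.range n).filter (fun k => k + 1 < n ∧ ¬ (z ∈ Br k ↔ z ∈ Br (k + 1)))).card ≤ 2 * U := by
    intro z
    refine le_trans (Finset.card_le_card ?_) (card_flips_exists_le n U (fun u₀ k => RB z u₀ k) (hRB z))
    intro k hk
    simp only [Finset.mem_filter] at hk ⊢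
    rw [hmemBr, hmemBr] at hk
    exact hk
  -- (4) state monotonicity along a fixed position
  have hmono₁ : ∀ k k', k < k' → k' < n → y k = y k' → jj k ≠ jj k' → s₁ (jj k) (y k) < s₁ (jj k') (y k) := by
    intro k k' hkk' hk' hyy hjj
    have hk : k < n := hkk'.trans hk'
    have h1 := u_lt_of_dominant d v ε τ s₁ s₂ A B hinj hpres hw (hyp k hk) (hyp k hk) (hdom k hk) (j' := jj k')
      (by rintro ⟨e, -⟩; exact hjj e)
    have h2 := u_lt_of_dominant d v ε τ s₁ s₂ A B hinj hpres hw (hyp k' hk') (hyp k' hk') (hdom k' hk') (j' := jj k)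
      (by rintro ⟨e, -⟩; exact hjj e.symm)
    rw [← hyy] at h2
    have t1 := ht k k' hkk' hk'
    nlinarith
  have hmono₂ : ∀ k k', k < k' → k' < n → p k = p k' → uu k ≠ uu k' → s₂ (p k) (uu k) < s₂ (p k) (uu k') := by
    intro k k' hkk' hk' hpp huu
    have hk : k < n := hkk'.trans hk'
    have h1 := w_lt_of_dominant d v ε τ s₁ s₂ A B hinj hpres hw (hyp k hk) (hyp k hk) (hdom k hk) (u' := uu k')
      (by rintro ⟨-, e⟩; exact huu e)
    have h2 := w_lt_of_dominant d v ε τ s₁ s₂ A B hinj hpres hw (hyp k' hk') (hyp k' hk') (hdom k' hk') (u' := uu k)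
      (by rintro ⟨-, e⟩; exact huu e.symm)
    rw [← hpp] at h2
    have t1 := ht k k' hkk' hk'
    nlinarith
  exact card_le_of_adjacent_records n Ar Br y p jj uu s₁ s₂ hadj hinj' hflipA hflipB hmono₁ hmono₂

end Family

end Summit.ValiantsHypothesis.ValiantsHypothesis.Theorems.KPlusLogSqLaw.ComparabilityLinear
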